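import Mathlib.AlgebraicGeometry.Normalization
import Mathlib.AlgebraicGeometry.Morphisms.Proper
import Mathlib.AlgebraicGeometry.Geometrically.Connected
import Mathlib.AlgebraicGeometry.Noetherian
import Mathlib.AlgebraicGeometry.Fiber
import Mathlib.RingTheory.IntegralClosure.IntegrallyClosed
import HarnessLib

/-!
# Stein factorisation: the fibres of `X → S'` are geometrically connected (Stacks Project, Tag 03H2)

Zariski's connectedness theorem in its Stein-factorisation form. The Stacks Project, Tag 03H2
(More on Morphisms, Theorem 37.53.5 "Stein factorization; general case"), printed statement:

> Let `S` be a scheme. Let `f : X → S` be a proper morphism. There exists a factorization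
> `f = π ∘ f'`, `f' : X → S'`, `π : S' → S`, with the following properties:
> (1) the morphism `f'` is proper with geometrically connected fibres,
> (2) the morphism `π : S' → S` is integral,
> (3) we have `f'_* 𝒪_X = 𝒪_{S'}`,
> (4) we have `S' = Spec_S(f_* 𝒪_X)`, and
> (5) `S'` is the normalization of `S` in `X`, see Morphisms, Definition 29.54.3 (Tag 035H).

(Tag 03H0 = Theorem 37.53.4 is the Noetherian case, where `π` is moreover finite.) The proof in
the Stacks Project goes through étale localisation and the lifting of idempotents from a fibre
`X_s` to a neighbourhood (Derived Categories of Schemes, Lemma 36.32.7), i.e. the theorem on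
formal functions together with the coherence of `f_* 𝒪_X`; none of this is in Mathlib.

Mathlib has the relative normalization `AlgebraicGeometry.Scheme.Hom.normalization f` of `S` in
`X` (tagged `@[stacks 035H]`, for `f` quasi-compact and quasi-separated), with the factorisation
`f = f.toNormalization ≫ f.fromNormalization` (`Scheme.Hom.toNormalization_fromNormalization`)
and `IsIntegralHom f.fromNormalization`, i.e. items (2) and (5); and it has
`AlgebraicGeometry.GeometricallyConnected` (for all `Spec K → S'`, `K` a field, the base change
is connected), which by `GeometricallyConnected.iff_geometricallyConnected_fiber` is exactly
"all fibres are geometrically connected" in the sense of Varieties, Definition 33.7.1 (Tag 0362).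
We vendor the deep part of item (1) — geometric connectedness of the fibres of
`f' = f.toNormalization` — as the named fact `Literature.AlgebraicGeometry.Morphisms.steinFactorization_geometricallyConnected`
(a sorry-free `Prop` definition; users take `(h : steinFactorization_geometricallyConnected)`),
and prove the corollary used downstream: if `f.fromNormalization` is an isomorphism (e.g.
`f_* 𝒪_X = 𝒪_S`), then `f` itself is geometrically connected (Zariski's connectedness theorem).
The elementary remainder of item (1) and of Lemma 37.53.1 (Tag 03GY) is proved outright: `f'` is
universally closed and surjective for `f` universally closed and quasi-separated
(`universallyClosed_toNormalization`, `surjective_toNormalization`), proper for `f` proper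
(`isProper_toNormalization`), and `f'^♯ : Γ(π⁻¹U, 𝒪_{S'}) → Γ(f⁻¹U, 𝒪_X)` is an isomorphism for
every affine open `U ⊆ S` (`isIso_toNormalization_app`, items (3)–(4): `f_* 𝒪_X` is integral
over `𝒪_S`, Tag 03GQ, by Mathlib's `isIntegral_appTop_of_universallyClosed`).

We also vendor the application printed right after the theorem, Tag 0AY8 (More on Morphisms,
Lemma 37.53.6): a proper `f : X → S` towards a normal integral `S`, with `X` reduced, all generic
points of irreducible components of `X` over the generic point `ξ` of `S`, and
`H⁰(X_ξ, 𝒪) = κ(ξ)`, satisfies `f_* 𝒪_X = 𝒪_S` and has geometrically connected fibres — as the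
named fact `Literature.AlgebraicGeometry.Morphisms.geometricallyConnected_towards_normal` (as printed, any `S`), with its
fibrewise form `geometricallyConnected_towards_normal.fiber`. (An earlier restatement of the same
lemma restricted to locally Noetherian `S`, `geometricallyConnected_towards_normal_locallyNoetherian`,
was merged back into this fact: it had no locator of its own — the printed lemma has no Noetherian
hypothesis — and followed from it in one line; consumers over locally Noetherian bases take
`(h : geometricallyConnected_towards_normal)`. Its proof in either generality is Zariski's
connectedness theorem: the theorem on formal functions for `H⁰`, Tag 02OC, for a proper,
not necessarily flat, scheme over a Noetherian local ring along its maximal ideal, and the étale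
neighbourhood criterion for geometric connectedness, Tag 03GZ.)

Filed for `Literature.AlgebraicGeometry.Motives.IntegralModel.geometricallyIrreducible_reductionAt`
(`Literature/AlgebraicGeometry/Motives/GoodReduction.lean`): the special fibre of a smooth proper
model with geometrically irreducible generic fibre is geometrically irreducible — since proved
unconditionally in `Literature/AlgebraicGeometry/Motives/GoodReductionZariskiProofs.lean` (Zariski's
argument on a projective Chow cover of the model over the discrete valuation ring), the conditional
routes through the facts of this file being kept in
`Literature/AlgebraicGeometry/Motives/GoodReductionSpecialFibreProofs.lean`.

Deliberately NOT here: item (2) of the Noetherian case, Tag 03H0 (Theorem 37.53.4 (2): for `S`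
locally Noetherian, `π : S' → S` is finite). Its printed proof is the coherence of `f_* 𝒪_X` for
`f` proper (EGA III₁ 3.2.1; Görtz–Wedhorn II, Thm. 24.49 (3) with Thm. 23.17: "By the coherence
theorem, `f_* 𝒪_X` is a coherent `𝒪_S`-module, hence `π` is finite"), a theory absent from
Mathlib; an earlier revision recorded it as a named fact `SteinFactorizationFinite`, retired
because its only consumer (de Jong 1996, 4.12, `Literature/AlgebraicGeometry/Resolution/
AlterationsFibresConnectedProofs.lean`) obtains the finiteness of `π` for free from its
étaleness (`π` is integral, and finite = integral + locally of finite type, Mathlib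
`IsFinite.iff_isIntegralHom_and_locallyOfFiniteType`).

## References

* The Stacks Project, Tag 03H2 (More on Morphisms, Theorem 37.53.5); Tag 03H0 (Theorem 37.53.4);
  Tag 0AY8 (Lemma 37.53.6); Tag 035H (Morphisms, Definition 29.54.3); Tag 0362 (Varieties,
  Definition 33.7.1); Tag 033H (Properties, Definition 28.7.1: normal schemes).
* A. Grothendieck, EGA III₁, Théorème 4.3.1 and Corollaires 4.3.2–4.3.4 (Zariski's connectedness
  theorem).
* R. Hartshorne, *Algebraic Geometry*, III.11.3 and III.11.5.
-/

noncomputable section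

open CategoryTheory AlgebraicGeometry

universe u

namespace Literature.AlgebraicGeometry.Morphisms

/-- NAMED FACT — **Stein factorisation: the fibres of `X → S'` are geometrically connected**
(The Stacks Project, Tag 03H2 = More on Morphisms, Theorem 37.53.5, item (1) with (5)): "Let `S`
be a scheme. Let `f : X → S` be a proper morphism. There exists a factorization `f = π ∘ f'` […]
(1) the morphism `f'` is proper with geometrically connected fibres, […] (5) `S'` is the
normalization of `S` in `X`." Here `S'` and `f'` are Mathlib's `f.normalization` and
`f.toNormalization` (`@[stacks 035H]`; `f` proper is quasi-compact and quasi-separated), and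
"geometrically connected fibres" is Mathlib's `GeometricallyConnected f.toNormalization`
(equivalent to the fibrewise condition by `GeometricallyConnected.iff_geometricallyConnected_fiber`).
Only this part of (1) is recorded as a named fact; the elementary parts — `f'` universally
closed, surjective and proper, item (2) (Mathlib's `IsIntegralHom f.fromNormalization`) and items
(3)–(4) affine-locally on `S` — are proved below (`isProper_toNormalization`,
`surjective_toNormalization`, `isIso_toNormalization_app`). Users take
`(h : steinFactorization_geometricallyConnected)`.
[cite: StacksProject, Tag 03H2 (More on Morphisms, Theorem 37.53.5 (1), (5))] -/
def steinFactorization_geometricallyConnected : Prop :=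
  ∀ ⦃X S : Scheme.{u}⦄ (f : X ⟶ S) [IsProper f], GeometricallyConnected f.toNormalization

/-! ## API -/

/-- Fibrewise form of the named fact: under Stein factorisation, every fibre of
`f' = f.toNormalization` is geometrically connected over its residue field (Mathlib
`GeometricallyConnected.iff_geometricallyConnected_fiber`). [cite: StacksProject, Tag 03H2 (More on Morphisms, Theorem 37.53.5 (1))] -/
theorem steinFactorization_geometricallyConnected.fiber
    (h : steinFactorization_geometricallyConnected.{u}) {X S : Scheme.{u}} (f : X ⟶ S)
    [IsProper f] (s' : ↥f.normalization) :
    GeometricallyConnected (f.toNormalization.fiberToSpecResidueField s') :=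
  (GeometricallyConnected.iff_geometricallyConnected_fiber _).mp (h f) s'

/-- **Zariski's connectedness theorem** (consequence of Stein factorisation): if `f : X → S` is
proper and `S' → S` is an isomorphism — i.e. `𝒪_S` is integrally closed in `f_* 𝒪_X`, e.g.
`f_* 𝒪_X = 𝒪_S` — then `f` has geometrically connected fibres (The Stacks Project, Tag 03H2 and
the discussion opening Section 37.53: "a proper morphism `f : X → S` with `f_*𝒪_X = 𝒪_S` has
connected fibres"; EGA III₁ 4.3.2). Proof: `f = f' ≫ π` with `π` an isomorphism, and
`GeometricallyConnected` respects isomorphisms. [cite: StacksProject, Tag 03H2 (More on Morphisms, Theorem 37.53.5 and Section 37.53)] -/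
theorem steinFactorization_geometricallyConnected.of_isIso_fromNormalization
    (h : steinFactorization_geometricallyConnected.{u}) {X S : Scheme.{u}} (f : X ⟶ S)
    [IsProper f] [IsIso f.fromNormalization] : GeometricallyConnected f := by
  have hf : GeometricallyConnected (f.toNormalization ≫ f.fromNormalization) :=
    MorphismProperty.RespectsIso.postcomp (P := @GeometricallyConnected) _ _ (h f)
  rwa [Scheme.Hom.toNormalization_fromNormalization] at hf

/-! ## The elementary parts of Tags 03GY and 03H2, proved

The Stacks Project proves Theorem 37.53.5 (Tag 03H2) on top of Lemma 37.53.1 (Tag 03GY, in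
Section 37.53 = Tag 03GX: for `f` universally closed and quasi-separated, (1) `f' : X → S'` is
universally closed, quasi-compact, quasi-separated and surjective, (2) `π` is integral, (3)
`f'_* 𝒪_X = 𝒪_{S'}`, (4) `S' = Spec_S(f_* 𝒪_X)`, (5) `S'` is the normalization of `S` in `X`)
and then notes: "besides the conclusions of Lemma 37.53.1 we also have that `f'` is separated
(Schemes, Lemma [Tag 01KV]) and finite type (Morphisms, Lemma [Tag 01T8]). Hence `f'` is proper.
At this point we have proved all of the statements except for the statement that `f'` has
geometrically connected fibres." We record these elementary parts, PROVED from Mathlib's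
relative normalization (`π = f.fromNormalization` is integral, hence affine and separated;
cancellation lemmas `UniversallyClosed.of_comp_of_isSeparated`, `IsProper.of_comp`;
`IsDominant f.toNormalization` and `surjective_of_isDominant_of_isClosed_range`;
`isIntegral_appTop_of_universallyClosed` and `Scheme.Hom.toNormalization_app_preimage` for
(3)–(4) affine-locally on `S`), so that together with the named fact
`steinFactorization_geometricallyConnected` all of item (1) of Tag 03H2 is available
(`steinFactorization_geometricallyConnected.item_one`). The deep remainder — geometric
connectedness of the fibres of `f'` — is the theorem on formal functions
(`Literature.AlgebraicGeometry.Morphisms.formalFunctions_H0`, Tag 02OC) with the lifting of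
idempotents (Tag 0G7X), Noetherian approximation of proper morphisms (Tag 0A0P) and étale
localisation (Tags 03GZ, 02LF, 0389); see the module docstring. -/

/-- **Lemma 37.53.1 (1), universal closedness** (The Stacks Project, Tag 03GY): for
`f : X → S` universally closed and quasi-separated (hence quasi-compact, Morphisms, Lemma
[Tag 04XU]), the morphism `f' = f.toNormalization : X → S'` to the normalization of `S` in `X`
is universally closed — printed proof: "The morphism `f'` is universally closed by Morphisms,
Lemma [Tag 01W6]", i.e. cancellation in `f = f' ≫ π` with `π` integral, hence separated.
[cite: StacksProject, Tag 03GY (More on Morphisms, Lemma 37.53.1 (1))] -/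
theorem universallyClosed_toNormalization {X S : Scheme.{u}} (f : X ⟶ S) [QuasiSeparated f]
    [UniversallyClosed f] : UniversallyClosed f.toNormalization := by
  have : UniversallyClosed (f.toNormalization ≫ f.fromNormalization) := by
    rw [Scheme.Hom.toNormalization_fromNormalization]
    infer_instance
  exact .of_comp_of_isSeparated _ f.fromNormalization

/-- **Lemma 37.53.1 (1), surjectivity** (The Stacks Project, Tag 03GY): for `f : X → S`
universally closed and quasi-separated, `f' = f.toNormalization : X → S'` is surjective — it is
dominant (Mathlib, `𝒪_{S'} → f'_* 𝒪_X` is injective) with closed image (printed proof: "As `f'`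
is universally closed the image of `f'` is a closed subset `V(I) ⊂ S' = Spec(A)` […] every
element of `I` is nilpotent […] `V(I) = S'`"). In particular every fibre of `f'` is nonempty.
[cite: StacksProject, Tag 03GY (More on Morphisms, Lemma 37.53.1 (1))] -/
theorem surjective_toNormalization {X S : Scheme.{u}} (f : X ⟶ S) [QuasiSeparated f]
    [UniversallyClosed f] : Surjective f.toNormalization :=
  haveI := universallyClosed_toNormalization f
  surjective_of_isDominant_of_isClosed_range _ f.toNormalization.isClosedMap.isClosed_range

/-- **`f_* 𝒪_X` is integral over `𝒪_S` for `f` universally closed, affine-locally on `S`**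
(The Stacks Project, Tag 03GQ (Morphisms, Section Tag 0BAK "Relative normalization"), the input
of Lemma 37.53.1 (4)–(5), Tag 03GY: for `f` quasi-compact, quasi-separated and universally
closed, "`f_* 𝒪_X` is integral over `𝒪_S`. In other words, the normalization of `S` in `X` is
equal to the factorization `X → Spec_S(f_* 𝒪_X) → S`"): for `f : X → S` universally closed and
`U ⊆ S` affine open, the ring map `Γ(U, 𝒪_S) → Γ(f⁻¹U, 𝒪_X)` is integral. Mathlib:
`isIntegral_appTop_of_universallyClosed` (the case `S` affine, `U = S`; Morphisms, Lemma
[Tag 01WM]) applied to the restriction `f ∣_ U : f⁻¹U → U`.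
[cite: StacksProject, Tag 03GQ (Morphisms, Section 0BAK) and Tag 03GY (More on Morphisms, Lemma 37.53.1 (4), (5))] -/
theorem isIntegral_app_of_universallyClosed {X S : Scheme.{u}} (f : X ⟶ S) [UniversallyClosed f]
    (U : S.affineOpens) : (f.app U).hom.IsIntegral := by
  haveI : IsAffine (U : S.Opens) := U.2
  have h := isIntegral_appTop_of_universallyClosed (f ∣_ (U : S.Opens))
  dsimp only [Scheme.Hom.appTop] at h
  rw [morphismRestrict_app'] at h
  have e₁ : (U : S.Opens).ι ''ᵁ ⊤ = U := (U : S.Opens).ι_image_top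
  have e₂ : (f ⁻¹ᵁ (U : S.Opens)).ι ''ᵁ ((f ∣_ (U : S.Opens)) ⁻¹ᵁ ⊤) = f ⁻¹ᵁ (U : S.Opens) := by
    rw [image_morphismRestrict_preimage, Scheme.Opens.ι_image_top]
  rw [Scheme.Hom.app_eq_appLE]
  exact (Scheme.Hom.appLE_congr f _ e₁ e₂ (fun g ↦ g.hom.IsIntegral)).mp h

/-- **Lemma 37.53.1 (3)–(4), affine-locally** (The Stacks Project, Tag 03GY: "we have
`f'_* 𝒪_X = 𝒪_{S'}`" and "`S' = Spec_S(f_* 𝒪_X)`"): for `f : X → S` universally closed and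
quasi-separated and `U ⊆ S` affine open, so that `π⁻¹U = Spec A'` with `A'` the integral closure
of `Γ(U, 𝒪_S)` in `Γ(f⁻¹U, 𝒪_X)` (Mathlib `Scheme.Hom.normalizationObjIso`) and
`f'⁻¹(π⁻¹U) = f⁻¹U`, the map `f'^♯ : Γ(π⁻¹U, 𝒪_{S'}) → Γ(f⁻¹U, 𝒪_X)` is an isomorphism — the
inclusion `A' ⊆ Γ(f⁻¹U, 𝒪_X)` is onto because `Γ(f⁻¹U, 𝒪_X)` is integral over `Γ(U, 𝒪_S)`
(`isIntegral_app_of_universallyClosed`); printed proof: "Then `S' = Spec(A)` with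
`A = Γ(X, 𝒪_X)` an integral `R`-algebra. Thus it is clear that `f'_* 𝒪_X` is `𝒪_{S'}`".
[cite: StacksProject, Tag 03GY (More on Morphisms, Lemma 37.53.1 (3), (4))] -/
theorem isIso_toNormalization_app {X S : Scheme.{u}} (f : X ⟶ S) [QuasiSeparated f]
    [UniversallyClosed f] (U : S.affineOpens) :
    IsIso (f.toNormalization.app (f.fromNormalization ⁻¹ᵁ U)) := by
  letI := (f.app U.1).hom.toAlgebra
  have hint : ∀ x : Γ(X, f ⁻¹ᵁ (U : S.Opens)), IsIntegral Γ(S, (U : S.Opens)) x :=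
    fun x ↦ isIntegral_app_of_universallyClosed f U x
  rw [f.toNormalization_app_preimage U]
  refine IsIso.comp_isIso' inferInstance (IsIso.comp_isIso' ?_ inferInstance)
  refine (ConcreteCategory.isIso_iff_bijective _).mpr ⟨fun x y hxy ↦ Subtype.val_injective hxy, ?_⟩
  intro x
  exact ⟨⟨x, hint x⟩, rfl⟩

/-- **Theorem 37.53.5 (1), elementary half: `f'` is proper** (The Stacks Project, Tag 03H2):
for `f : X → S` proper, `f' = f.toNormalization : X → S'` is proper — printed proof: "`f'` is
separated (Schemes, Lemma 26.21.13) and finite type (Morphisms, Lemma 29.15.8). Hence `f'` is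
proper" (cancellation in `f = f' ≫ π`, `π` integral hence separated; Mathlib `IsProper.of_comp`).
[cite: StacksProject, Tag 03H2 (More on Morphisms, Theorem 37.53.5 (1))] -/
theorem isProper_toNormalization {X S : Scheme.{u}} (f : X ⟶ S) [IsProper f] :
    IsProper f.toNormalization := by
  have : IsProper (f.toNormalization ≫ f.fromNormalization) := by
    rw [Scheme.Hom.toNormalization_fromNormalization]
    infer_instance
  exact IsProper.of_comp f.toNormalization f.fromNormalization

/-- **Theorem 37.53.5 (1) in full, under the named fact** (The Stacks Project, Tag 03H2 (1) with
(5)): for `f : X → S` proper, `f' = f.toNormalization : X → S'` is proper (proved,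
`isProper_toNormalization`), surjective (proved, `surjective_toNormalization`) and has
geometrically connected fibres (the named fact `steinFactorization_geometricallyConnected`).
[cite: StacksProject, Tag 03H2 (More on Morphisms, Theorem 37.53.5 (1), (5))] -/
theorem steinFactorization_geometricallyConnected.item_one
    (h : steinFactorization_geometricallyConnected.{u}) {X S : Scheme.{u}} (f : X ⟶ S)
    [IsProper f] :
    IsProper f.toNormalization ∧ Surjective f.toNormalization ∧
      GeometricallyConnected f.toNormalization :=
  ⟨isProper_toNormalization f, surjective_toNormalization f, h f⟩

/-! ## Proper morphisms towards a normal base (Stacks Project, Tag 0AY8) -/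

/-- NAMED FACT — **proper morphisms towards a normal scheme have geometrically connected fibres**
(The Stacks Project, Tag 0AY8 = More on Morphisms, Lemma 37.53.6, printed right after Stein
factorisation as "an application"): "Let `f : X → S` be a morphism of schemes. Assume
(1) `f` is proper, (2) `S` is integral with generic point `ξ`, (3) `S` is normal, (4) `X` is
reduced, (5) every generic point of an irreducible component of `X` maps to `ξ`, (6) we have
`H⁰(X_ξ, 𝒪) = κ(ξ)`. Then `f_* 𝒪_X = 𝒪_S` and `f` has geometrically connected fibres."
Lean phrasing: (2) `IsIntegral S`, `ξ = genericPoint S`; (3) all local rings `𝒪_{S,s}` are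
integrally closed in their fraction fields (Properties, Definition 28.7.1, Tag 033H: `S` is normal
iff every `𝒪_{S,s}` is a normal domain; they are domains as `S` is integral); (4) `IsReduced X`;
(5) `x ∈ genericPoints X` (Mathlib: the generic points of the irreducible components) implies
`f x = ξ`; (6) `κ(ξ) = Γ(Spec κ(ξ), 𝒪) → Γ(X_ξ, 𝒪)` is an isomorphism, for Mathlib's
scheme-theoretic fibre `f.fiber ξ = X ×_S Spec κ(ξ)` and `f.fiberToSpecResidueField ξ`;
conclusion: `𝒪_S(U) → 𝒪_X(f⁻¹U)` is an isomorphism for every open `U ⊆ S` (i.e.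
`𝒪_S → f_* 𝒪_X` is an isomorphism of sheaves) and `GeometricallyConnected f` (Mathlib; all fibres
geometrically connected, `GeometricallyConnected.iff_geometricallyConnected_fiber`). The printed
proof applies Tag 03H2 and shows `S' = S` (an integral birational morphism onto a normal scheme
is an isomorphism). Users take `(h : geometricallyConnected_towards_normal)`.
[cite: StacksProject, Tag 0AY8 (More on Morphisms, Lemma 37.53.6)] -/
def geometricallyConnected_towards_normal : Prop :=
  ∀ ⦃X S : Scheme.{u}⦄ (f : X ⟶ S) [IsProper f] [IsIntegral S]
    (_hS : ∀ s : S, IsIntegrallyClosed (S.presheaf.stalk s)) [IsReduced X]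
    (_hX : ∀ x ∈ genericPoints X, f.base x = genericPoint S)
    (_hξ : IsIso (f.fiberToSpecResidueField (genericPoint S)).appTop),
    (∀ U : S.Opens, IsIso (f.app U)) ∧ GeometricallyConnected f

/-! ## API for Tag 0AY8 -/

/-- Fibrewise form of Tag 0AY8: under its hypotheses, every fibre `X_s → Spec κ(s)` is
geometrically connected (Mathlib `GeometricallyConnected.iff_geometricallyConnected_fiber`).
[cite: StacksProject, Tag 0AY8 (More on Morphisms, Lemma 37.53.6)] -/
theorem geometricallyConnected_towards_normal.fiber
    (h : geometricallyConnected_towards_normal.{u}) {X S : Scheme.{u}} (f : X ⟶ S) [IsProper f]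
    [IsIntegral S] (hS : ∀ s : S, IsIntegrallyClosed (S.presheaf.stalk s)) [IsReduced X]
    (hX : ∀ x ∈ genericPoints X, f.base x = genericPoint S)
    (hξ : IsIso (f.fiberToSpecResidueField (genericPoint S)).appTop) (s : S) :
    GeometricallyConnected (f.fiberToSpecResidueField s) :=
  (GeometricallyConnected.iff_geometricallyConnected_fiber _).mp (h f hS hX hξ).2 s

/-- The first conclusion of Tag 0AY8 at the level of global sections: `Γ(S, 𝒪_S) → Γ(X, 𝒪_X)`
is an isomorphism (the case `U = ⊤` of `f_* 𝒪_X = 𝒪_S`).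
[cite: StacksProject, Tag 0AY8 (More on Morphisms, Lemma 37.53.6)] -/
theorem geometricallyConnected_towards_normal.isIso_appTop
    (h : geometricallyConnected_towards_normal.{u}) {X S : Scheme.{u}} (f : X ⟶ S) [IsProper f]
    [IsIntegral S] (hS : ∀ s : S, IsIntegrallyClosed (S.presheaf.stalk s)) [IsReduced X]
    (hX : ∀ x ∈ genericPoints X, f.base x = genericPoint S)
    (hξ : IsIso (f.fiberToSpecResidueField (genericPoint S)).appTop) : IsIso f.appTop :=
  (h f hS hX hξ).1 ⊤

end Literature.AlgebraicGeometry.Morphisms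

end
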